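import Mathlib
import Summits.Ventures.PercRepro2.SkeletonClasses

/-!
# Degrees never grow along a reduction; (HCOV) without unmarked branch vertices (blind cell
PercRepro2, night-1 g16; NIGHT1-G16.md §5)

* **`nzDeg_le_of_step` / `nzDeg_le_of_reduces`**: the nonzero-degree of EVERY vertex is
  non-increasing along every skeleton move (re-routing keeps it, zeroing a loop or a leaf edge and
  merging lower it, the series contraction moves one edge of the far end onto the other);
* **`HCov_of_nzDeg_le_two`**: if every unmarked vertex has nonzero-degree `≤ 2` (no unmarked branch
  vertex: the unmarked vertices lie on paths and cycles between marks), (HCOV) holds — the Simple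
  reduct has no unmarked vertex with a nonzero edge, so every nonzero edge at `a₃` joins two marks
  (class R₃, `HCov_of_reduces_marks_at_a3`).  Cycles and necklaces with the five marks placed
  anywhere (S3.7 (C7)), subdivided marked graphs, theta graphs with marked branch points, … are
  instances.

Own code; standard axioms.
-/

open scoped Classical

namespace Summit.Ventures.PercRepro2

open UnionCluster CovForm

namespace Skeleton

section Degree

variable {V : Type*} {E : Type*} [Fintype E] [DecidableEq E] {R : Type*} [Field R]

/-- The nonzero edges at `v`. -/
noncomputable def nzAt (p : E → R) (ends : E → Sym2 V) (v : V) : Finset E :=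
  Finset.univ.filter (fun e => v ∈ ends e ∧ p e ≠ 0)

omit [DecidableEq E] in
/-- Membership in `nzAt`. -/
lemma mem_nzAt {p : E → R} {ends : E → Sym2 V} {v : V} {e : E} :
    e ∈ nzAt p ends v ↔ v ∈ ends e ∧ p e ≠ 0 := by
  simp [nzAt]

omit [DecidableEq E] in
/-- `nzDeg` is the cardinality of `nzAt`. -/
lemma nzDeg_eq_card (p : E → R) (ends : E → Sym2 V) (v : V) :
    nzDeg p ends v = (nzAt p ends v).card := rfl

/-- Zeroing any edge does not raise the nonzero-degree. -/
lemma nzDeg_update_zero_le (p : E → R) (ends : E → Sym2 V) (f : E) (v : V) :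
    nzDeg (Function.update p f 0) ends v ≤ nzDeg p ends v := by
  rw [nzDeg_eq_card, nzDeg_eq_card]
  apply Finset.card_le_card
  intro e he
  rw [mem_nzAt] at he ⊢
  refine ⟨he.1, ?_⟩
  intro h0
  apply he.2
  by_cases hef : e = f
  · subst hef; simp
  · rw [Function.update_of_ne hef]; exact h0

omit [DecidableEq E] in
/-- Re-routing the zero-weight edges keeps every nonzero-degree. -/
lemma nzDeg_congr_nz (p : E → R) {ends ends' : E → Sym2 V} (h : ∀ e, p e ≠ 0 → ends e = ends' e)
    (v : V) : nzDeg p ends' v = nzDeg p ends v := by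
  rw [nzDeg_eq_card, nzDeg_eq_card]
  congr 1
  ext e
  rw [mem_nzAt, mem_nzAt]
  constructor
  · rintro ⟨he, hp⟩; exact ⟨by rw [h e hp]; exact he, hp⟩
  · rintro ⟨he, hp⟩; exact ⟨by rw [← h e hp]; exact he, hp⟩

omit [Fintype E] in
/-- A set contained in `S` with `f'` removed and `f` possibly added — where `f` can be present only
if `f'` was in `S` or `f` itself was — is not larger than `S`. -/
lemma card_le_of_subset_erase_insert {S T : Finset E} {f f' : E}
    (hsub : T ⊆ insert f (S.erase f')) (hf : f ∈ T → f' ∈ S ∨ f ∈ S.erase f') :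
    T.card ≤ S.card := by
  by_cases hfT : f ∈ T
  · rcases hf hfT with hf'S | hfS
    · calc T.card ≤ (insert f (S.erase f')).card := Finset.card_le_card hsub
        _ ≤ (S.erase f').card + 1 := Finset.card_insert_le _ _
        _ = S.card := by
          rw [Finset.card_erase_of_mem hf'S]
          have := Finset.card_pos.2 ⟨f', hf'S⟩
          omega
    · rw [Finset.insert_eq_of_mem hfS] at hsub
      calc T.card ≤ (S.erase f').card := Finset.card_le_card hsub
        _ ≤ S.card := Finset.card_erase_le
  · have hsub' : T ⊆ S.erase f' := by
      intro e he
      have := hsub he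
      rw [Finset.mem_insert] at this
      rcases this with rfl | h
      · exact absurd he hfT
      · exact h
    calc T.card ≤ (S.erase f').card := Finset.card_le_card hsub'
      _ ≤ S.card := Finset.card_erase_le

/-- The merge of two parallel edges does not raise any nonzero-degree. -/
lemma nzDeg_merge_le (p : E → R) (ends : E → Sym2 V) {e₁ e₂ : E} (hne : e₁ ≠ e₂)
    (hpar : ends e₁ = ends e₂) (v : V) :
    nzDeg (Function.update (Function.update p e₁ (1 - (1 - p e₁) * (1 - p e₂))) e₂ 0) ends v ≤
      nzDeg p ends v := by
  rw [nzDeg_eq_card, nzDeg_eq_card]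
  refine card_le_of_subset_erase_insert (f := e₁) (f' := e₂) ?_ ?_
  · intro e he
    rw [mem_nzAt] at he
    rw [Finset.mem_insert, Finset.mem_erase, mem_nzAt]
    by_cases he1 : e = e₁
    · exact Or.inl he1
    · right
      have he2 : e ≠ e₂ := by
        intro hh; subst hh; simp at he
      refine ⟨he2, he.1, ?_⟩
      have := he.2
      rwa [Function.update_of_ne he2, Function.update_of_ne he1] at this
  · intro h1
    rw [mem_nzAt] at h1
    rw [Function.update_of_ne hne, Function.update_self] at h1
    by_cases h2 : p e₂ = 0
    · right
      rw [Finset.mem_erase, mem_nzAt]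
      refine ⟨hne, h1.1, ?_⟩
      intro h0
      apply h1.2
      rw [h0, h2]; ring
    · left
      rw [mem_nzAt]
      exact ⟨by rw [← hpar]; exact h1.1, h2⟩

/-- The series contraction does not raise any nonzero-degree. -/
lemma nzDeg_series_le (p : E → R) (ends : E → Sym2 V) {f f' : E} {x w w' : V} (hff : f ≠ f')
    (hf : ends f = s(x, w)) (hf' : ends f' = s(x, w')) (v : V) :
    nzDeg (Function.update (Function.update p f (p f * p f')) f' 0)
        (Function.update ends f s(w, w')) v ≤ nzDeg p ends v := by
  rw [nzDeg_eq_card, nzDeg_eq_card]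
  refine card_le_of_subset_erase_insert (f := f) (f' := f') ?_ ?_
  · intro e he
    rw [mem_nzAt] at he
    rw [Finset.mem_insert, Finset.mem_erase, mem_nzAt]
    by_cases hef : e = f
    · exact Or.inl hef
    · right
      have hef' : e ≠ f' := by
        intro hh; subst hh; simp at he
      refine ⟨hef', ?_, ?_⟩
      · have := he.1; rwa [Function.update_of_ne hef] at this
      · have := he.2; rwa [Function.update_of_ne hef', Function.update_of_ne hef] at this
  · intro h1
    rw [mem_nzAt, Function.update_of_ne hff, Function.update_self, Function.update_self] at h1
    have hne : p f ≠ 0 ∧ p f' ≠ 0 := by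
      constructor
      · intro h0; apply h1.2; rw [h0]; ring
      · intro h0; apply h1.2; rw [h0]; ring
    rcases Sym2.mem_iff.1 h1.1 with hv | hv
    · right
      rw [Finset.mem_erase, mem_nzAt, hf, hv]
      exact ⟨hff, Sym2.mem_mk_right x w, hne.1⟩
    · left
      rw [mem_nzAt, hf', hv]
      exact ⟨Sym2.mem_mk_right x w', hne.2⟩

end Degree

section Monotone

variable {V : Type*} {E : Type*} [Fintype E] [DecidableEq E] [Fintype V] [DecidableEq V]
  {R : Type*} [Field R] [LinearOrder R] [IsStrictOrderedRing R]

variable {o a₁ a₂ a₃ b : V}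

omit [Fintype V] [DecidableEq V] [LinearOrder R] [IsStrictOrderedRing R] in
/-- **No nonzero-degree grows under a skeleton move.** -/
theorem nzDeg_le_of_step {I J : (E → R) × (E → Sym2 V)} (h : Step o a₁ a₂ a₃ b I J) (v : V) :
    nzDeg J.1 J.2 v ≤ nzDeg I.1 I.2 v := by
  cases h with
  | @reroute p _ _ hr => exact le_of_eq (nzDeg_congr_nz p hr v)
  | @loop p ends e _ _ => exact nzDeg_update_zero_le p ends e v
  | @leaf p ends f _ _ _ _ _ _ _ _ _ _ => exact nzDeg_update_zero_le p ends f v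
  | @series p ends f f' _ _ _ hff hf hf' _ _ _ _ _ _ _ _ => exact nzDeg_series_le p ends hff hf hf' v
  | @merge p ends _ _ hne hpar => exact nzDeg_merge_le p ends hne hpar v

omit [Fintype V] [DecidableEq V] [LinearOrder R] [IsStrictOrderedRing R] in
/-- **No nonzero-degree grows along a reduction.** -/
theorem nzDeg_le_of_reduces {I J : (E → R) × (E → Sym2 V)} (h : Reduces o a₁ a₂ a₃ b I J)
    (v : V) : nzDeg J.1 J.2 v ≤ nzDeg I.1 I.2 v := by
  induction h with
  | refl => exact le_rfl
  | tail _ hbc ih => exact le_trans (nzDeg_le_of_step hbc v) ih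

/-- **(HCOV) without unmarked branch vertices**: if every unmarked vertex has nonzero-degree `≤ 2`
and the five marks are distinct, (HCOV) holds. -/
theorem HCov_of_nzDeg_le_two (p : E → R) (ends : E → Sym2 V) (hp : IsProbVec p)
    (hinj : Function.Injective (Hub3.markOf3 o a₁ a₂ a₃ b))
    (hdeg : ∀ v, v ≠ o → v ≠ a₁ → v ≠ a₂ → v ≠ a₃ → v ≠ b → nzDeg p ends v ≤ 2) :
    HCov p ends o a₁ a₂ a₃ b := by
  obtain ⟨J, hJ, hJs⟩ := exists_reduces_simple o a₁ a₂ a₃ b p ends hp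
  obtain ⟨q, ends'⟩ := J
  refine HCov_of_reduces_marks_at_a3 hp hJ hinj ?_
  intro e he hae
  obtain ⟨y, hy⟩ := Sym2.mem_iff_exists.1 hae
  -- `y` is a mark: an unmarked `y` would have nonzero-degree `≥ 1` but `≤ 2`, hence `0` by `Simple`
  suffices hmark : ∃ m, y = Hub3.markOf3 o a₁ a₂ a₃ b m by
    obtain ⟨m, rfl⟩ := hmark
    exact ⟨m, hy⟩
  by_contra hy'
  have hyo : y ≠ o := fun hh => hy' ⟨Hub.Mark.o, by rw [hh]; rfl⟩
  have hy1 : y ≠ a₁ := fun hh => hy' ⟨Hub.Mark.a₁, by rw [hh]; rfl⟩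
  have hy2 : y ≠ a₂ := fun hh => hy' ⟨Hub.Mark.a₂, by rw [hh]; rfl⟩
  have hy3 : y ≠ a₃ := fun hh => hy' ⟨Hub.Mark.a₃, by rw [hh]; rfl⟩
  have hyb : y ≠ b := fun hh => hy' ⟨Hub.Mark.b, by rw [hh]; rfl⟩
  have hle : nzDeg q ends' y ≤ 2 :=
    le_trans (nzDeg_le_of_reduces (I := (p, ends)) (J := (q, ends')) hJ y) (hdeg y hyo hy1 hy2 hy3 hyb)
  have hpos : 1 ≤ nzDeg q ends' y := by
    rw [nzDeg_eq_card]
    exact Finset.card_pos.2 ⟨e, mem_nzAt.2 ⟨by rw [hy]; exact Sym2.mem_mk_right a₃ y, he⟩⟩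
  have hs := (hJs.1 y hyo hy1 hy2 hy3 hyb).2
  dsimp only at hs
  rcases hs with h0 | h3 <;> omega

end Monotone

end Skeleton

end Summit.Ventures.PercRepro2
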